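import Mathlib
import HarnessLib
import Summits.MatrixMultiplication.MatrixMultiplication.Theses.OutsiderSandwich
import Summits.MatrixMultiplication.MatrixMultiplication.Theorems.OutsiderSandwichSquaredLaserPacking

/-!
# Line «block-one transfer» for the crux `LaserTangency` (stmt-MatrixMultiplication-32268)

Route `route-MatrixMultiplication-OutsiderSandwich`, cut of record
`closes (LaserTangency) (LaserMergeOptimal) (SummitIffLaserTangency)`.  decomp-mm lens-4
(«minimal counterexample / extremal reduction»), g18.

THE LINE.  `LaserTangency ⟸ BlockOneIsMM ⟸ BlockOneAsymptoticRestriction`: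

* the tree PROVES `BlockOneIsMM → LaserTangency` hypothesis-free
  (`OutsiderSandwichSquaredLaserPacking.laserTangency_of_blockOneIsMM`, g18: squared laser packing
  + laser descent + `couplingIsMM_of_blockIsMM`), where `BlockOneIsMM` (item 27147, ω-FREE) says
  `F⟨2,2,2⟩ ≤ F(C₁)` for every universal spectral point and `C₁` is ONE explicit `4×4×4` coupled
  block of `cw₂ ⊗ cw₂` (`C₁ = Σ_{a₁,a₂∈{1,2}} x_{a₁a₂} (y_{0a₂} z_{a₁0} + y_{a₁0} z_{0a₂})`, two copies
  of `⟨2,2,1⟩` glued along the `x`-leg; `Q̃(C₁) = 4`, `R̲(C₁) = 6`, `R(C₁) ≤ 7`);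
* `stub_blockOneAsymptoticRestriction` (TENSOR side, the load-bearing stub): `C₁^{⊠N}` helped by a
  unit tensor of size `2^{εN}` RESTRICTS to `⟨2,2,2⟩^{⊠N}` for infinitely many `N`, every `ε > 0` —
  a statement about explicit 0/1 tensors, checkable degree by degree (single copy is impossible:
  `R̲(C₁) = 6 < 7 = R̲⟨2,2,2⟩`, tree `OutsiderSandwichBlockOneRank`);
* `stub_spectralTransfer` (SPECTRAL side, routine `F`-transfer: monotonicity, multiplicativity,
  `F⟨B⟩ = B`, `N`-th roots, `ε → 0`): the restriction statement implies `BlockOneIsMM`.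

By Strassen's spectral theorem the tensor statement is EQUIVALENT to `BlockOneIsMM` (asymptotic
preorder ⟺ pointwise order on the asymptotic spectrum), so the transfer exposes the one-block
inequality to CONSTRUCTION (explicit restrictions on powers) instead of quantifying over unknown
spectral points.  [Strassen1988, Thm. 3.8]; [CoppersmithWinograd1990, §7];
[BurgisserClausenShokrollahi1997, §15.6]; [ChristandlVranaZuiddam2023, §1.1].
-/

noncomputable section

open Literature.Computability.AlgebraicComplexity
open Summit.MatrixMultiplication.MatrixMultiplication.Theorems.OutsiderSandwichCoupling (coupling₁)

namespace Summit.MatrixMultiplication.MatrixMultiplication.Cruxes.LaserTangency.BlockOneTransfer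

/-- **Stub 1 (tensor side, load-bearing): `C₁` restricts to `⟨2,2,2⟩` asymptotically** — for every
`ε > 0` and infinitely many `N`, `⟨B⟩ ⊠ C₁^{⊠N} ⊵ ⟨2,2,2⟩^{⊠N}` with `B ≤ 2^{εN}`. -/
theorem stub_blockOneAsymptoticRestriction :
    ∀ ε : ℝ, 0 < ε → ∀ N₀ : ℕ, ∃ N : ℕ, N₀ ≤ N ∧ ∃ B : ℕ,
      TensorRestrictsTo (kroneckerTensor (unitTensor ℂ B) (kroneckerPow coupling₁ N))
        (kroneckerPow (matMulTensor ℂ 2 2 2) N) ∧ (B : ℝ) ≤ (2 : ℝ) ^ (ε * N) := by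
  sorry

/-- **Stub 2 (spectral transfer): the asymptotic restriction forces `F⟨2,2,2⟩ ≤ F(C₁)`** for every
universal spectral point (apply `F`, take `N`-th roots, let `ε → 0`). -/
theorem stub_spectralTransfer :
    (∀ ε : ℝ, 0 < ε → ∀ N₀ : ℕ, ∃ N : ℕ, N₀ ≤ N ∧ ∃ B : ℕ,
      TensorRestrictsTo (kroneckerTensor (unitTensor ℂ B) (kroneckerPow coupling₁ N))
        (kroneckerPow (matMulTensor ℂ 2 2 2) N) ∧ (B : ℝ) ≤ (2 : ℝ) ^ (ε * N)) →
    Summit.MatrixMultiplication.MatrixMultiplication.Theses.OutsiderSandwich.BlockOneIsMM := by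
  sorry

/-- **Composition (kernel-checked): the two stubs give the crux `LaserTangency` BY NAME**, through
the tree theorem `BlockOneIsMM → LaserTangency` (`laserTangency_of_blockOneIsMM`, p800628). The stubs are
USED as proofs (tree convention for registered skeletons: `<Crux>_of : <Crux>` with no hypotheses, so the
`#h21_check_skeleton` lint sees only named obligations; writer g7 mechanical re-spelling of lens-4 g18's
curried statement `stub₁ → stub₂ → LaserTangency`, proof term `laserTangency_of_blockOneIsMM (h₂ h₁)`,
mathematics unchanged). -/
theorem LaserTangency_of :
    Summit.MatrixMultiplication.MatrixMultiplication.Theses.OutsiderSandwich.LaserTangency :=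
  Theorems.OutsiderSandwichSquaredLaserPacking.laserTangency_of_blockOneIsMM
    (stub_spectralTransfer stub_blockOneAsymptoticRestriction)

end Summit.MatrixMultiplication.MatrixMultiplication.Cruxes.LaserTangency.BlockOneTransfer
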